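import Summits.KontsevichZagierPeriods.KontsevichZagierPeriods.Theorems.HurwitzMicroSectorsNormalFormPrincipleL2W3PrismShuffle
import Summits.KontsevichZagierPeriods.KontsevichZagierPeriods.Theorems.HurwitzMicroSectorsNormalFormPrincipleL2W3PrismDilationMove

/-!
# `NormalFormPrinciple` (stmt-KontsevichZagierPeriods-3869), line `SketchIdeator1` —
# leaf `stub_boxRigidity`, layer `M3` (words kernel): the log cube is six copies of the word `ccc`

Pure proof file (registered sub-goal `m3x_logCube_sub_six_ccc` of the extended M3 kernel capstone,
lead seat c9; `--supports` the crux). With the letter `c(u) = 1/(1+u)`, the log-cube box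
`B3 = [(0,1)³, c(x₀) c(x₁) c(x₂)]` (value `(log 2)³`) carries an integrand symmetric under all
permutations of the coordinates, so inside the Kontsevich–Zagier calculus it is SIX copies of the
word representation `[Δ, ccc]` over the decreasing open simplex `Δ = {0 < t₂ < t₁ < t₀ < 1}`
(value `(log 2)³/6`):

  `[B3] − 6•[Δ, ccc] ∈ KZ.relations`.

Chain of moves: cut the cube by the Lebesgue-null plane `{x₀ = x₁}` (rule (1): restriction of
`B3` off the plane, `KZ.IntegralRep.of_sub_of_restrict_mem_relations`, then one domain-additivity
move, rule (1a)) into the two prisms `P = {0 < t₁ < t₀ < 1} × {0 < t₂ < 1}` and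
`P' = {0 < t₀ < t₁ < 1} × {0 < t₂ < 1}`; identify `[B3|P']` with `[B3|P]` by the coordinate swap
`0 ↔ 1` (rule (2), `KZ.of_sub_of_reindex_mem_relations`; the integrand is swap-symmetric); and
dissect each prism into three copies of the word by the landed shuffle dissection
`l2w3_prism_shuffle` (with `f = g = h = c` all three target words are `ccc`).

References: M. Kontsevich, D. Zagier, *Periods* (2001), §1.1–1.2, rules (1), (2). No definitions
are introduced.
-/

noncomputable section

open MeasureTheory Set
open Literature.NumberTheory.Transcendental Literature.NumberTheory.Transcendental.KZ
open Literature.ModelTheory.ExponentialFields (IsSemialgebraic)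

namespace Summit.KontsevichZagierPeriods.HurwitzMicroSectors.NormalFormPrinciple.PiBox.M3

/-! ## The swapped prism -/

/-- The domain of a representation over the prism `P = {0 < t₁ < t₀ < 1} × {0 < t₂ < 1}`
reindexed along `Equiv.swap 0 1` is the mirror prism `P' = {0 < t₀ < t₁ < 1} × {0 < t₂ < 1}`.
[folklore] -/
theorem m3q_reindex_swap_domain (T : IntegralRep 3)
    (hTd : T.domain = {t | 0 < t 1 ∧ t 1 < t 0 ∧ t 0 < 1 ∧ 0 < t 2 ∧ t 2 < 1}) :
    (T.reindex (Equiv.swap (0 : Fin 3) 1)).domain =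
      {t | 0 < t 0 ∧ t 0 < t 1 ∧ t 1 < 1 ∧ 0 < t 2 ∧ t 2 < 1} := by
  -- adapted from `l2s_reindex_swap_domain` (…L2W3PrismShuffle)
  have hs2 : Equiv.swap (0 : Fin 3) 1 2 = 2 := by decide
  ext w
  simp only [IntegralRep.reindex_domain, hTd, mem_setOf_eq, Equiv.swap_apply_left,
    Equiv.swap_apply_right, hs2]

/-- The integrand of a representation of the (swap-symmetric) log-cube integrand
`1/((1+t₀)(1+t₁)(1+t₂))` reindexed along `Equiv.swap 0 1` agrees with the same function on its
domain. [folklore] -/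
theorem m3q_reindex_swap_integrand (T : IntegralRep 3)
    (hTi : EqOn T.integrand (fun t => 1 / ((1 + t 0) * (1 + t 1) * (1 + t 2))) T.domain) :
    EqOn (T.reindex (Equiv.swap (0 : Fin 3) 1)).integrand
      (fun t => 1 / ((1 + t 0) * (1 + t 1) * (1 + t 2)))
      (T.reindex (Equiv.swap (0 : Fin 3) 1)).domain := by
  -- adapted from `l2s_reindex_swap_integrand` (…L2W3PrismShuffle)
  intro w hw
  have hw' : (fun i => w (Equiv.swap (0 : Fin 3) 1 i)) ∈ T.domain := by
    rw [IntegralRep.reindex_domain] at hw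
    exact hw
  rw [IntegralRep.reindex_integrand]
  show T.integrand (fun i => w (Equiv.swap (0 : Fin 3) 1 i)) =
    1 / ((1 + w 0) * (1 + w 1) * (1 + w 2))
  have hs2 : Equiv.swap (0 : Fin 3) 1 2 = 2 := by decide
  rw [hTi hw']
  simp only [Equiv.swap_apply_left, Equiv.swap_apply_right, hs2]
  ring

/-- The letter product form of the log-cube integrand:
`1/((1+a)(1+b)(1+c)) = c(a)·c(b)·c(c)` with `c(u) = 1/(1+u)`. [folklore] -/
theorem m3q_one_div_mul_three (a b c : ℝ) :
    1 / ((1 + a) * (1 + b) * (1 + c)) = 1 / (1 + a) * (1 / (1 + b)) * (1 / (1 + c)) := by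
  rw [one_div_mul_one_div, one_div_mul_one_div]

/-! ## The registered sub-goal -/

/-- **Stub X2 (`m3x_logCube_sub_six_ccc`; registered sub-goal of stmt-KontsevichZagierPeriods-3869,
line `SketchIdeator1`, layer `M3` words kernel).** The log cube is six copies of the word `ccc`:
for any representation `B3` over the open unit cube whose integrand agrees there with
`1/((1+x₀)(1+x₁)(1+x₂))` and any representation `CCC` over the decreasing simplex
`Δ = {0 < t₂ < t₁ < t₀ < 1}` with integrand `c(t₀) c(t₁) c(t₂)`, `c(u) = 1/(1+u)`,
`[B3] − 6•[CCC] ∈ KZ.relations`: cut the cube by the null plane `{x₀ = x₁}` into the prisms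
`P = {0 < t₁ < t₀ < 1} × {0 < t₂ < 1}` and its mirror `P'` (rules (1), (1a)), carry `[B3|P]` onto
`[B3|P']` by the coordinate swap `0 ↔ 1` (rule (2)), and dissect `[B3|P]` into three copies of
`[CCC]` by the shuffle dissection `l2w3_prism_shuffle`.
[cite: KontsevichZagier2001, §1.2 rules (1), (2)] -/
theorem m3x_logCube_sub_six_ccc :
    ∀ (B3 CCC : IntegralRep 3), B3.domain = {x | ∀ i, x i ∈ Set.Ioo (0:ℝ) 1} →
      EqOn B3.integrand (fun x => 1 / ((1 + x 0) * (1 + x 1) * (1 + x 2))) B3.domain →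
      CCC.domain = {t | 0 < t 2 ∧ t 2 < t 1 ∧ t 1 < t 0 ∧ t 0 < 1} →
      (CCC.integrand = fun t => 1 / (1 + t 0) * (1 / (1 + t 1)) * (1 / (1 + t 2))) →
      of B3 - (6:ℤ) • of CCC ∈ relations := by
  intro B3 CCC hB3d hB3i hCCCd hCCCi
  -- the prism `P` inside the cube and the restricted representation `TP = B3|P`
  have hP := l2q_isSemialgebraic_prism
  have hPr : {t : Fin 3 → ℝ | 0 < t 1 ∧ t 1 < t 0 ∧ t 0 < 1 ∧ 0 < t 2 ∧ t 2 < 1} ⊆ B3.domain := by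
    rw [hB3d]
    exact fun t ht => Fin.forall_fin_succ.2 ⟨⟨ht.1.trans ht.2.1, ht.2.2.1⟩,
      Fin.forall_fin_two.2 ⟨⟨ht.1, ht.2.1.trans ht.2.2.1⟩, ⟨ht.2.2.2.1, ht.2.2.2.2⟩⟩⟩
  have hTPd : (B3.restrict _ hP hPr).domain =
      {t | 0 < t 1 ∧ t 1 < t 0 ∧ t 0 < 1 ∧ 0 < t 2 ∧ t 2 < 1} := rfl
  have hTPi : EqOn (B3.restrict _ hP hPr).integrand
      (fun t => 1 / ((1 + t 0) * (1 + t 1) * (1 + t 2))) (B3.restrict _ hP hPr).domain :=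
    fun t ht => hB3i (hPr ht)
  have hTPB : (B3.restrict _ hP hPr).integrand = B3.integrand := rfl
  generalize B3.restrict _ hP hPr = TP at hTPd hTPi hTPB
  -- the mirror prism `Ts = TP ∘ swap 0 1` and the permutation move `[TP] − [Ts]` (rule 2)
  have hsd := m3q_reindex_swap_domain TP hTPd
  have hsi := m3q_reindex_swap_integrand TP hTPi
  have e2 : of TP - of (TP.reindex (Equiv.swap (0 : Fin 3) 1)) ∈ relations :=
    of_sub_of_reindex_mem_relations TP (Equiv.swap (0 : Fin 3) 1)
  generalize TP.reindex (Equiv.swap (0 : Fin 3) 1) = Ts at hsd hsi e2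
  -- the two prisms sit inside the cube
  have hsubP : TP.domain ⊆ B3.domain := by
    rw [hTPd]
    exact hPr
  have hsubS : Ts.domain ⊆ B3.domain := by
    rw [hsd, hB3d]
    exact fun t ht => Fin.forall_fin_succ.2 ⟨⟨ht.1, ht.2.1.trans ht.2.2.1⟩,
      Fin.forall_fin_two.2 ⟨⟨ht.1.trans ht.2.1, ht.2.2.1⟩, ⟨ht.2.2.2.1, ht.2.2.2.2⟩⟩⟩
  have hE : IsSemialgebraic ℚ (TP.domain ∪ Ts.domain) :=
    TP.isSemialgebraic_domain.union Ts.isSemialgebraic_domain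
  have hEr : TP.domain ∪ Ts.domain ⊆ B3.domain := union_subset hsubP hsubS
  -- the cutting plane `{t₀ = t₁}` is null
  have hplane : volume {t : Fin 3 → ℝ | t 0 = t 1} = 0 :=
    l2s_volume_setOf_apply_eq_apply 0 1 (by decide)
  -- the complement of the two prisms in the cube lies on the plane
  have hvol : volume (B3.domain \ (TP.domain ∪ Ts.domain)) = 0 := by
    refine measure_mono_null (fun t ht => ?_) hplane
    rw [hB3d, hTPd, hsd] at ht
    obtain ⟨hb, hn⟩ := ht
    have hb : ∀ i, t i ∈ Set.Ioo (0:ℝ) 1 := hb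
    show t 0 = t 1
    by_contra hne
    rcases lt_or_gt_of_ne hne with h | h
    · exact hn (Or.inr ⟨(hb 0).1, h, (hb 1).2, (hb 2).1, (hb 2).2⟩)
    · exact hn (Or.inl ⟨(hb 1).1, h, (hb 0).2, (hb 2).1, (hb 2).2⟩)
  -- the two prisms are disjoint
  have hint : volume (TP.domain ∩ Ts.domain) = 0 := by
    refine measure_mono_null (fun t ht => ?_) hplane
    rw [hTPd, hsd] at ht
    exact absurd (ht.1.2.1.trans ht.2.2.1) (lt_irrefl _)
  -- move 0 (rule 1): `[B3] − [B3|E]`, `E = P ∪ P'` co-null in the cube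
  have e0 : of B3 - of (B3.restrict _ hE hEr) ∈ relations :=
    B3.of_sub_of_restrict_mem_relations hE hEr hvol
  -- move 1 (rule 1a): `[B3|E] − [TP] − [Ts]`
  have e1 : of (B3.restrict _ hE hEr) - of TP - of Ts ∈ relations :=
    domainAddRel_subset_relations ⟨3, B3.restrict _ hE hEr, TP, Ts, rfl, hint,
      fun t _ => (congrFun hTPB t).symm,
      fun t ht => (hB3i (hsubS ht)).trans (hsi ht).symm, rfl⟩
  -- the shuffle dissection of the prism: `[TP] − 3•[CCC]` (three copies of the word `ccc`)
  have hCi : EqOn CCC.integrand (fun t => 1 / (1 + t 0) * (1 / (1 + t 1)) * (1 / (1 + t 2)))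
      CCC.domain := fun t _ => congrFun hCCCi t
  have hTPi' : EqOn TP.integrand (fun t => 1 / (1 + t 0) * (1 / (1 + t 1)) * (1 / (1 + t 2)))
      TP.domain := fun t ht => (hTPi ht).trans (m3q_one_div_mul_three (t 0) (t 1) (t 2))
  have e3 : of TP - of CCC - of CCC - of CCC ∈ relations :=
    l2w3_prism_shuffle (fun u => 1 / (1 + u)) (fun u => 1 / (1 + u)) (fun u => 1 / (1 + u))
      TP CCC CCC CCC hTPd hTPi' hCCCd hCi hCCCd hCi hCCCd hCi
  -- bookkeeping
  have e : of B3 - (6:ℤ) • of CCC = (of B3 - of (B3.restrict _ hE hEr)) +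
      (of (B3.restrict _ hE hEr) - of TP - of Ts) - (of TP - of Ts) +
      (2:ℤ) • (of TP - of CCC - of CCC - of CCC) := by
    abel
  rw [e]
  exact relations.add_mem (relations.sub_mem (relations.add_mem e0 e1) e2)
    (relations.zsmul_mem e3 2)

end Summit.KontsevichZagierPeriods.HurwitzMicroSectors.NormalFormPrinciple.PiBox.M3
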